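import Summits.CriticalPhenomena.SAWScalingLimit.Theses.SAWDevelopingMap
import Summits.CriticalPhenomena.SAWScalingLimit.Theses.SAWResidueField
import Summits.CriticalPhenomena.SAWScalingLimit.Cruxes.HexTight.Disproof
import Summits.CriticalPhenomena.SAWScalingLimit.Theorems.HexTight.Negative.NotRenewalGluing

/-!
# Line `tip-renewal-complementarity` — skeleton for crux `HexTight` (stmt-CriticalPhenomena-5423)

Crux (FIXED; shared by routes SAWDevelopingMap / SAWResidueField / SAWWindingAlias /
SAWPhaseRetrieval; item keyed at `Summit.CriticalPhenomena.SAWScalingLimit.Theses.SAWResidueField.HexTight`,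
all copies syntactically equal)
— eventual tightness (`IsTightAlongMesh`) of the critical hexagonal SAW laws `hexSAWLaw` for every
Dobrushin domain and every hexagonal endpoint approximation.

## The line (idea card `Ideas/tip-renewal-complementarity.md`, triage r1: pass ×3)

Kemppainen–Smirnov's Condition G2 is the natural tightness criterion for a model with the exact
domain Markov property; for the SAW the conditional law given a past is the critical walk in the
SLIT DOMAIN `Λ = Ω_δ ∖ past`, started at the TIP mid-edge `t` and PINNED at the target. The
card's levers: from-the-tip functionals are treated as RATIOS of `x_c`-weighted arc masses (the
parafermionic observable's boundary sums; the complementarity floor `Σ_h ‖F_t(h)‖ ≥ 1` and the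
tip's signed sum rule are the exact lattice identities behind them), and re-basing the source from
the tip to THICK ("flat") sources at lattice scale `k` costs constants `K(k)` only.

Kernel-checked composition (`HexTight_of` / `HexTight_proof`, no `sorry` outside `stub_*`):

  S1 `TipNoReturn`, S2 `TipRebasing`, S3 `CoherentDecay`, S4 `PinnedDecoupling`
    —S5→ `LatticeG2SC` —S6→ `LatticeG2` —S7→ `∀ D a b, IsEmbEndpointApprox … → HexTraversalBound D a b`
    —`Disproof.crux_of_traversalBound`→ `HexTight`

through the disprover's checked Aizenman–Burchard rung (§6 of `Cruxes/HexTight/Disproof.lean`,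
cdisprove gen 2).

## Stubs (7; the only sorries of the file)

* `stub_tipNoReturn`       (S1) no return to the tip, all scales: from the tip of any past, among
  the boundary arcs that engage an annulus `A(x; r, Cr)` enclosing the tip, those making a
  SIDE EXCURSION (a radial traversal of one annulus component touching a foreign side, between two
  visits of one side) carry an `x_c`-mass fraction `≤ ε`, `ε → 0` as `C → ∞` — the card's LNR_k
  at every scale, unpinned, in the observable's currency.
* `stub_tipRebasing`       (S2) TIP RENEWAL, the card's lever (iii): conditional side-excursion FRACTIONS
  from a tip are at most `K(k)` times the worst such fraction from a THICK source (renewal gluing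
  = `Negative.RenewalGluingNe`, first-exit decomposition, lattice-scale no-return).
* `stub_coherentDecay`     (S3) the card's (CD) for THICK sources: far side excursions carry a
  conditional fraction `≤ ε(C) → 0` (differentiated sum rule + strip/lid decay; cheapest
  falsifier: UNIFORM LID DECAY numerics).
* `stub_pinnedDecoupling`  (S4) PINNING: the pinned (point-target) probability of a side excursion
  is `≤ K ×` the unpinned fraction of the same event conditioned on engaging the annulus
  (separation of scales; takes over the role of the card's (LF), see the line card).
* `stub_latticeG2sc_of`    (S5) ASSEMBLY: S1–S4 ⇒ lattice Condition G2 for pinned critical SAW in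
  every SIMPLY CONNECTED finite hexagonal domain (the SIDES LEMMA "unforced ⇒ side excursion",
  case split on the annulus' position relative to the tip).
* `stub_floatingPast`      (S6) the (G1) residual of every observable line (triage r1-3): lattice G2
  for NON-simply-connected slit domains (interior lattice endpoints make the past float).
* `stub_traversalBound_of` (S7) DICTIONARY + KEMPPAINEN–SMIRNOV: lattice G2 ⇒ Aizenman–Burchard (H1)
  `HexTraversalBound` for every `(D, a, b)` (domain Markov property of `hexSAWLaw`, interior-target
  encoding, cut edges of `embMeshGraph`, KS17 Prop. 3.5 / Lemma 3.6 with the shell-dependent forced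
  count, lattice cutoff).

All statements are over existing declarations (`HexMidEdgeSAW`, `hexCriticalFugacity`,
`hexGraph`, `hexCenter`, `hexMidpoint`, `hexDomainBoundary`, `hexDomainSimplyConnected`,
`hexSAWLaw`, `IsEmbEndpointApprox`, `Curve.HasTraversals`) plus the transparent bookkeeping
`def`s of §1 (arc masses, lattice crossing events).

## Disproof used (`Cruxes/HexTight/Disproof.lean`, gen 2)

* §1/§2b: every statement below concerns HONEST ensembles (boundary source ≠ target, genuine
  walks); junk regimes only help the crux.
* §2 `hexTight_false_without_endpointLimits`: the endpoint limits are used exactly once, inside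
  `Disproof.crux_of_traversalBound` (via `eventually_ne_and_reachable`); S7 may use them again for
  the finiteness of the forced count `n₀`.
* §3e: the output shape is the per-approximation `∃ δ₀` form `HexTraversalBound` — no all-meshes
  (S1), no uniform threshold (S2: the forced count and `δ₀` depend on `(D, a, b)`), no finite net
  (S3).
* §4 `hexEventualTight_iff_crux`: either form of the crux is served by the same chain.
* §6 `crux_of_traversalBound` + `not_hasTraversals_sawCurve` (H0 proved): the composition.
* Landed negative `Theorems/HexTight/Negative/NotRenewalGluing.lean`: the renewal step of S2 is the
  REPAIRED `Negative.RenewalGluingNe` (`a ≠ b`), never `RenewalGluingAsTyped`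
  (`Negative.not_renewalGluingAsTyped`); no stub restates either.
-/

noncomputable section

open scoped BigOperators
open Classical
open Literature.Probability.LatticeModels
open Literature.Probability.RandomPlanarGeometry
open Literature.Probability.RandomPlanarGeometry.SAW

namespace Summit.CriticalPhenomena.SAWScalingLimit.Cruxes.HexTight.TipRenewalComplementarity

/-! ## §1 Bookkeeping: arc masses and lattice crossing events (mesh 1, positions `hexCenter`) -/

/-- Pinned arc mass `Z_Λ(a → z) = Σ_{γ ⊂ Λ : a → z} x_c^{ℓ(γ)}` (the observable at spin `0`). -/
def arcMass (Λ : Finset HexVertex) (a z : Sym2 HexVertex) : ℝ :=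
  ∑ γ : HexMidEdgeSAW Λ a z, hexCriticalFugacity ^ γ.length

/-- Pinned arc mass restricted to an event `E` on the list of visited vertices. -/
def arcMassIf (Λ : Finset HexVertex) (a z : Sym2 HexVertex) (E : List HexVertex → Prop) : ℝ :=
  ∑ γ : HexMidEdgeSAW Λ a z, if E γ.verts then hexCriticalFugacity ^ γ.length else 0

/-- Unpinned (total) arc mass from the source `a`, restricted to `E`: the sum over ALL boundary
mid-edges `h ∈ ∂Λ` of the restricted pinned masses `a → h` — the `x_c`-weight of the
boundary-to-boundary arcs from `a` (the currency of the observable's boundary sum rules; with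
`E = True` it is `≥ 1` for `a ∈ ∂Λ` by the trivial walk, and the complementarity floor
`Sketch.ComplementarityFloor` says the part over `h ≠ a` alone is `≥ 1`). -/
def totalMassIf (Λ : Finset HexVertex) (a : Sym2 HexVertex) (E : List HexVertex → Prop) : ℝ :=
  ∑ᶠ h ∈ hexDomainBoundary Λ, arcMassIf Λ a h E

/-- `u` and `w` are joined by a path of the hexagonal lattice all of whose vertices lie in `S`. -/
def LatticeJoined (S : Set HexVertex) (u w : HexVertex) : Prop :=
  ∃ p : hexGraph.Walk u w, ∀ y ∈ p.support, y ∈ S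

/-- The vertices of `Λ` in the open annulus `A(x; r, R) = {r < |· - x| < R}` (lattice units). -/
def annVerts (Λ : Finset HexVertex) (x : ℂ) (r R : ℝ) : Set HexVertex :=
  {y | y ∈ Λ ∧ r < dist (hexCenter y) x ∧ dist (hexCenter y) x < R}

/-- The connected component of `y₀` in the annulus part of `Λ` (lattice version of KS's
"connected component of `z` in `U_τ ∩ A`"). -/
def annComp (Λ : Finset HexVertex) (x : ℂ) (r R : ℝ) (y₀ : HexVertex) : Set HexVertex :=
  {y | LatticeJoined (annVerts Λ x r R) y₀ y}

/-- The list `l` of visited vertices contains a CROSSING of the shell `D(x; r, R)` whose interior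
vertices satisfy `P`: consecutive vertices `u, u', …, w` with `u` in the closed inner ball and `w`
outside the open outer ball, or the other way round, and all vertices strictly between
satisfying `P` (Aizenman–Burchard traversal / KS crossing, lattice form; the first interior
vertex is `u'`). -/
def HasCrossingWith (P : HexVertex → Prop) (x : ℂ) (r R : ℝ) (l : List HexVertex) : Prop :=
  ∃ (l₁ l₂ l₃ : List HexVertex) (u u' w : HexVertex),
    l = l₁ ++ u :: u' :: l₂ ++ w :: l₃ ∧
    ((dist (hexCenter u) x ≤ r ∧ R ≤ dist (hexCenter w) x) ∨
      (R ≤ dist (hexCenter u) x ∧ dist (hexCenter w) x ≤ r)) ∧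
    ∀ y ∈ u' :: l₂, P y

/-- An INWARD crossing with named feet: consecutive vertices `u, u', …, w` of `l` with the OUTER
FOOT `u` outside the open outer ball, the INNER FOOT `w` in the closed inner ball, and all vertices
strictly between satisfying `P`. -/
def IsInwardCrossing (P : HexVertex → Prop) (x : ℂ) (r R : ℝ) (l : List HexVertex)
    (u w : HexVertex) : Prop :=
  ∃ (l₁ l₂ l₃ : List HexVertex) (u' : HexVertex),
    l = l₁ ++ u :: u' :: l₂ ++ w :: l₃ ∧
    R ≤ dist (hexCenter u) x ∧ dist (hexCenter w) x ≤ r ∧ ∀ y ∈ u' :: l₂, P y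

/-- An OUTWARD crossing with named feet: consecutive vertices `w, w', …, u` of `l` with the inner
foot `w` in the closed inner ball, the outer foot `u` outside the open outer ball, and all
vertices strictly between satisfying `P`. -/
def IsOutwardCrossing (P : HexVertex → Prop) (x : ℂ) (r R : ℝ) (l : List HexVertex)
    (w u : HexVertex) : Prop :=
  ∃ (l₁ l₂ l₃ : List HexVertex) (w' : HexVertex),
    l = l₁ ++ w :: w' :: l₂ ++ u :: l₃ ∧
    dist (hexCenter w) x ≤ r ∧ R ≤ dist (hexCenter u) x ∧ ∀ y ∈ w' :: l₂, P y

/-- KS's UNFORCED crossing, lattice form, judged in the domain `Λ` with tip vertex `vt` and target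
vertex `vz` (the `Λ`-endpoints of the source and target mid-edges): a crossing of `A(x; r, R)`
inside ONE annulus component `V` of `Λ` which is AVOIDABLE — `vt` and `vz` are joined by a lattice
path inside `Λ ∖ V` (Kemppainen–Smirnov 2017, Def. 2.3: `V` "doesn't disconnect `γ(τ)` from
`b` in `U_τ`"; tree: `unforcedPart`). -/
def UnforcedCrossing (Λ : Finset HexVertex) (vt vz : HexVertex) (x : ℂ) (r R : ℝ)
    (l : List HexVertex) : Prop :=
  ∃ y₀ : HexVertex, y₀ ∈ annVerts Λ x r R ∧
    HasCrossingWith (fun y => y ∈ annComp Λ x r R y₀) x r R l ∧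
    LatticeJoined ((↑Λ : Set HexVertex) \ annComp Λ x r R y₀) vt vz

/-- A **SIDE EXCURSION** through the annulus — the target-free shadow of Kemppainen–Smirnov's
unforced crossing, and the event of the UNPINNED statements S1–S4. For some annulus component
`V` of `Λ`: the arc visits a vertex `p`, later a vertex `p'` on the SAME SIDE of `V` (joined to
`p` by a lattice path inside `Λ ∖ V`), and in between makes a radial crossing of `A(x; r, R)`
inside `V` at least one of whose two feet is NOT on that side. Since the components of `Λ ∖ V`
communicate only through `V`, this says: between two visits of one side the arc made a full
radial traversal of `V` touching a foreign side — a dive into a foreign inner pocket and back, a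
sortie to a foreign outer bay with a dive, a hairpin. What it correctly EXCLUDES (and what is
typical, not rare, for unpinned arcs): a passage THROUGH an inner region with two exits, a passage
ALONG a corridor of width between `r` and `R` that brushes the wall within `r` of `x`, wandering
inside `V` — in each of these the arc never returns to a side it left. For a PINNED walk `t → z`
in a simply connected `Λ`, every KS-unforced crossing yields a side excursion with
`(p, p') = (v_t, v_z)` (the SIDES LEMMA of `stub_latticeG2sc_of`: the two feet of a radial
crossing through `V` lie in different components of `Λ ∖ V`). -/
def SideExcursion (Λ : Finset HexVertex) (x : ℂ) (r R : ℝ) (l : List HexVertex) : Prop :=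
  ∃ y₀ : HexVertex, y₀ ∈ annVerts Λ x r R ∧
    ∃ (l₁ l₂ l₃ : List HexVertex) (p p' a b : HexVertex),
      l = l₁ ++ p :: l₂ ++ p' :: l₃ ∧
      LatticeJoined ((↑Λ : Set HexVertex) \ annComp Λ x r R y₀) p p' ∧
      (IsInwardCrossing (fun y => y ∈ annComp Λ x r R y₀) x r R (p :: l₂ ++ [p']) a b ∨
        IsOutwardCrossing (fun y => y ∈ annComp Λ x r R y₀) x r R (p :: l₂ ++ [p']) a b) ∧
      (¬ LatticeJoined ((↑Λ : Set HexVertex) \ annComp Λ x r R y₀) p a ∨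
        ¬ LatticeJoined ((↑Λ : Set HexVertex) \ annComp Λ x r R y₀) p b)

/-- The arc visits the closed ball `|· - x| ≤ ρ`. -/
def Reaches (x : ℂ) (ρ : ℝ) (l : List HexVertex) : Prop :=
  ∃ y ∈ l, dist (hexCenter y) x ≤ ρ

/-- The arc travels to distance `≥ ρ` from the point `c` (used with `c` = its own source). -/
def Travels (c : ℂ) (ρ : ℝ) (l : List HexVertex) : Prop :=
  ∃ y ∈ l, ρ ≤ dist (hexCenter y) c

/-- The CONDITIONING event of the scale-free fractions: the arc from the source at `c` reaches
the `2R`-neighbourhood of `x` and travels at least `R/4` from its own source (so that lazy short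
arcs from flat sources, which dominate their totals, are not in the reference ensemble). Every
side excursion through `A(x; r, R)`, `2r ≤ R`, satisfies it. -/
def Engages (x : ℂ) (R : ℝ) (c : ℂ) (l : List HexVertex) : Prop :=
  Reaches x (2 * R) l ∧ Travels c (R / 4) l

/-- A THICK source at scale `k ≥ 1`: within distance `4k` of the source mid-edge `p` there is a
full lattice ball of radius `k` (at least a hexagon of cells) inside the complement of `Λ` — a
"flat"/bay source, as opposed to the tip of a slit (a past is a width-one path). The re-based
doors on the small circle `∂B(t, 2k)` of the card are thick in `Λ ∖ B(t, 2k)`; the tip of a past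
in the bulk is not. -/
def ThickSource (Λ : Finset HexVertex) (p : Sym2 HexVertex) (k : ℝ) : Prop :=
  ∃ y : HexVertex, dist (hexCenter y) (hexMidpoint p) ≤ 4 * k ∧
    ∀ w : HexVertex, dist (hexCenter w) (hexCenter y) ≤ k → w ∉ Λ

/-! ## §2 The statements of the line

All fractions below are CONDITIONAL and scale-free: numerator = `x_c`-mass of arcs making a
side excursion through `A(x; r, R)`, denominator = `x_c`-mass of arcs that ENGAGE the
annulus (`Engages x R (source position)`); the numerator event implies the denominator event, so
each fraction is a conditional probability of the unpinned (resp. pinned) `x_c`-ensemble. -/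

/-- **(S1) No return to the tip, at every scale** (the card's LNR generalised; unpinned,
conditional ratio form). For every `ε > 0` there are `C > 1` and a lattice cutoff `n₁` such that
for every SIMPLY CONNECTED finite domain `Λ`, every boundary source mid-edge `t = {u, v}`
(`u ∉ Λ`, `v ∈ Λ`: think of the tip of the past) and every annulus `A(x; r, R)`, `n₁ ≤ r`,
`C r ≤ R`, ENCLOSING the source (`dist(x, t) < R`): among the boundary arcs from `t` that engage
the annulus (travel `≥ R/4` from the tip), those making a side excursion carry a fraction `≤ ε`
of the `x_c`-mass. Every such event contains a full radial traversal of one annulus component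
that touches a side foreign to a side visited before and after — a return towards the walk's
own tip region (within `2R`) at precision `r = R/C`, or a dive into a pocket and back; forced
re-entries and through-passages are not counted.
Why plausibly true: tip non-loitering of SLE(8/3)-type curves with scale separation `1/C`; the
tip's signed sum rule (card lever (ii)) isolates exactly these tadpole/hook masses as the
remainder of an exact identity. Why it might fail: uniformity over all pasts; the observable sees
the hook term only with a sign. Size L (open; "LNR_k is lattice-scale G2", triage r1-1/2). -/
def TipNoReturn : Prop :=
  ∀ ε : ℝ, 0 < ε → ∃ C : ℝ, ∃ n₁ : ℕ, 1 < C ∧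
    ∀ (Λ : Finset HexVertex), hexDomainSimplyConnected Λ →
      ∀ (u v : HexVertex), u ∉ Λ → v ∈ Λ → hexGraph.Adj u v →
      ∀ (x : ℂ) (r R : ℝ), (n₁ : ℝ) ≤ r → C * r ≤ R → dist x (hexMidpoint s(u, v)) < R →
        totalMassIf Λ s(u, v) (SideExcursion Λ x r R) ≤
          ε * totalMassIf Λ s(u, v) (Engages x R (hexMidpoint s(u, v)))

/-- **(S2) Tip renewal / re-basing** (the card's lever (iii)): for every lattice scale `k ≥ 1`
there is `K = K(k) > 0` such that ANY uniform bound `M` on the conditional side-excursion fractions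
from THICK sources (scale `k`, annuli at distance `≥ R/2`, parameters `C`, `n₁`) transfers, up to
the factor `K`, to EVERY boundary source (tips included) of every simply connected domain, for
annuli at distance `≥ R`, `R ≥ 8k`, same parameters. Mechanism: remove the lattice ball
`B(t, 2k)`; LOWER-bound the engaged mass from `t` by renewal gluing (`Negative.RenewalGluingNe`:
inner piece inside the ball × outer arc from a thick door `p ∈ ∂B(t, 2k)` of `Λ ∖ B(t, 2k)`,
which is again simply connected and has the same annulus components), UPPER-bound the
side-excursion mass by the first-exit decomposition plus a lattice-scale no-return estimate
(re-entries of `B(t, 2k)` by arcs making the far U-turn cost `C(k)`: the card's LNR_k proper,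
"finitely many inner configurations"), and take the ratio of sums (≤ max ratio over doors; no
source-Harnack needed, cf. triage r1-3); the `R/4`-travel conditions of `t` and of the doors
differ by `≤ 2k + 1 ≤ R/4`, absorbed by monotonicity in `R`. Why it might fail: the past may WEAVE
across `∂B(t, 2k)` (forced re-entries), outside-only doors, forced returns through gaps near the
tip — every single-sphere form of LNR_k is false under adversarial pasts (line card §Pitfalls),
so the proof itself must count only side excursions. Size M–L. -/
def TipRebasing : Prop :=
  ∀ k : ℕ, 1 ≤ k → ∃ K : ℝ, 0 < K ∧ ∀ (M C : ℝ) (n₁ : ℕ), 0 ≤ M →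
    (∀ (Λ : Finset HexVertex), hexDomainSimplyConnected Λ →
      ∀ (u v : HexVertex), u ∉ Λ → v ∈ Λ → hexGraph.Adj u v → ThickSource Λ s(u, v) k →
      ∀ (x : ℂ) (r R : ℝ), (n₁ : ℝ) ≤ r → C * r ≤ R → R / 2 ≤ dist x (hexMidpoint s(u, v)) →
        totalMassIf Λ s(u, v) (SideExcursion Λ x r R) ≤
          M * totalMassIf Λ s(u, v) (Engages x R (hexMidpoint s(u, v)))) →
    ∀ (Λ : Finset HexVertex), hexDomainSimplyConnected Λ →
      ∀ (u v : HexVertex), u ∉ Λ → v ∈ Λ → hexGraph.Adj u v →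
      ∀ (x : ℂ) (r R : ℝ), (n₁ : ℝ) ≤ r → (8 * k : ℝ) ≤ R → C * r ≤ R →
        R ≤ dist x (hexMidpoint s(u, v)) →
          totalMassIf Λ s(u, v) (SideExcursion Λ x r R) ≤
            K * M * totalMassIf Λ s(u, v) (Engages x R (hexMidpoint s(u, v)))

/-- **(S3) Coherent decay from thick sources** (the card's (CD), observable-free conditional mass
form): for every thickness scale `k ≥ 1` and `ε > 0` there are `C > 1`, `n₁` such that in every
simply connected domain, from every THICK boundary source `p`, for every annulus `A(x; r, R)`,
`n₁ ≤ r`, `C r ≤ R`, `dist(x, p) ≥ R/2`: among the arcs from `p` that engage the annulus (reach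
`|· - x| ≤ 2R` and travel `≥ R/4`), those making a side excursion carry a fraction `≤ ε` — a
radial traversal at relative scale `2/C` into a foreign pocket or bay between two visits of one
side is a pure detour (a hairpin if it happens in a corridor). Mechanism: the differentiated sum rule / strong Markov identity (card
differentiated-sum-rule, `Sketch.StrongMarkovIdentity`: MAIN(`F^Λ − F^{Λ'}`) = DOOR − WALL) prices
visit-and-return from a COHERENT source by door + wall fluxes; the complementarity floor
(`Sketch.ComplementarityFloor`, provable now) turns fluxes into fractions; gate fluxes decay in
the modulus `log C` (`tendsto_stripBlim`; Krachun–Panagiotis arXiv:2310.17299 recurrences);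
first-entry renewal localises to the engaged sub-ensemble. Cheapest falsifier: UNIFORM LID DECAY
`sup_T E_{T,mT}(x_c) → 0` by honeycomb-strip transfer matrices (card; triage r1-3 F(1)) — a
stall kills (CD) for every parafermionic route. Why it might fail: hooks around a nearby slit
tip enter the sum rule with negative coefficients; uniformity over fjorded boundaries. Size L
(open, "arc-RSW" upper half). -/
def CoherentDecay : Prop :=
  ∀ k : ℕ, 1 ≤ k → ∀ ε : ℝ, 0 < ε → ∃ C : ℝ, ∃ n₁ : ℕ, 1 < C ∧
    ∀ (Λ : Finset HexVertex), hexDomainSimplyConnected Λ →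
      ∀ (u v : HexVertex), u ∉ Λ → v ∈ Λ → hexGraph.Adj u v → ThickSource Λ s(u, v) k →
      ∀ (x : ℂ) (r R : ℝ), (n₁ : ℝ) ≤ r → C * r ≤ R → R / 2 ≤ dist x (hexMidpoint s(u, v)) →
        totalMassIf Λ s(u, v) (SideExcursion Λ x r R) ≤
          ε * totalMassIf Λ s(u, v) (Engages x R (hexMidpoint s(u, v)))

/-- **(S4) Pinned decoupling** (the pinning step; takes over the role of the card's (LF)): there is
a universal `K` such that in every simply connected domain, for the PINNED ensemble `t → z`
(source `t = {u₀,v₀}`, target `z = {u₁,v₁}`, both boundary mid-edges, `t ≠ z`) and every annulus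
`A(x; r, R)`, `n₁ ≤ r`, `2r ≤ R`, the fraction of pinned mass making a side excursion is at
most `K` times the UNPINNED conditional fraction from `t` of the same geometric event given that
the arc engages the annulus (cross-multiplied; the same event on both sides —
all Kemppainen–Smirnov topology is in S5). The conditioning (reach `2R` AND travel `R/4` from the
source) is what makes the comparison scale-free: it removes the lazy short arcs that dominate
the totals of flat sources, and the pinned walk, which must leave its source and reach the
target, is compared only with arcs that got going. Why plausibly true: separation of scales —
the U-turn is a local decision at scale `R`; after travelling, the moving tip of an unpinned arc
is a tip (far field comparable), and the point constraint at `z` acts through a factor common to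
numerator and denominator (conformal-restriction heuristics for SLE(8/3)). Why it might fail:
no decoupling / quasi-multiplicativity technology exists for planar SAW; the continuation value
to a POINT target is multifractal (triage r1-3 on card continuation-value-reverse-holder), so
only a ratio form like this one — never a density or Hölder bound — can hold; annuli around the
target and sources "behind" the target direction are the delicate cases (reversal of
`HexMidEdgeSAW` available). Size L (open). HARDEST stub: no mechanism on record; the card's (LF)
"`Z_p(J) ≥ c · Σ_h ‖F_p(h)‖` for macroscopic arcs `J`" does not reach point targets (and fails for
flat sources on a flat boundary by the `s^{-5/4}` boundary decay), which is why it is replaced. -/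
def PinnedDecoupling : Prop :=
  ∃ K : ℝ, ∃ n₁ : ℕ, 0 < K ∧
    ∀ (Λ : Finset HexVertex), hexDomainSimplyConnected Λ →
      ∀ (u₀ v₀ u₁ v₁ : HexVertex), u₀ ∉ Λ → v₀ ∈ Λ → hexGraph.Adj u₀ v₀ →
      u₁ ∉ Λ → v₁ ∈ Λ → hexGraph.Adj u₁ v₁ → s(u₀, v₀) ≠ s(u₁, v₁) →
      ∀ (x : ℂ) (r R : ℝ), (n₁ : ℝ) ≤ r → 2 * r ≤ R →
        arcMassIf Λ s(u₀, v₀) s(u₁, v₁) (SideExcursion Λ x r R) *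
            totalMassIf Λ s(u₀, v₀) (Engages x R (hexMidpoint s(u₀, v₀))) ≤
          K * arcMass Λ s(u₀, v₀) s(u₁, v₁) *
            totalMassIf Λ s(u₀, v₀) (SideExcursion Λ x r R)

/-- **Lattice Condition G2 for pinned critical SAW** in the finite hexagonal domains satisfying
`P` (Kemppainen–Smirnov 2017, Condition G2, lattice/slit-domain form): one `C > 1`, one `q < 1`
and a lattice cutoff `n₁` such that for every such `Λ`, boundary source `t = {u₀,v₀}`, boundary
target `z = {u₁,v₁}` (`t ≠ z`), and every annulus `A(x; r, R)` with `n₁ ≤ r`, `C r ≤ R` whose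
closed inner ball meets the complement of `Λ` (KS: "`∂B(x,r) ∩ ∂U_τ ≠ ∅`" — lattice boundary or
past), the `x_c`-mass of walks `t → z` making an unforced crossing is at most `q · Z_Λ(t → z)`,
i.e. `P(unforced crossing ∣ past) ≤ q` by the domain Markov property (KS Cor. 2.7: any `q < 1`
will do). -/
def LatticeG2With (P : Finset HexVertex → Prop) : Prop :=
  ∃ C q : ℝ, ∃ n₁ : ℕ, 1 < C ∧ q < 1 ∧
    ∀ (Λ : Finset HexVertex), P Λ → ∀ (u₀ v₀ u₁ v₁ : HexVertex), u₀ ∉ Λ → v₀ ∈ Λ →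
      hexGraph.Adj u₀ v₀ → u₁ ∉ Λ → v₁ ∈ Λ → hexGraph.Adj u₁ v₁ → s(u₀, v₀) ≠ s(u₁, v₁) →
      ∀ (x : ℂ) (r R : ℝ), (n₁ : ℝ) ≤ r → C * r ≤ R →
        (∃ y : HexVertex, y ∉ Λ ∧ dist (hexCenter y) x ≤ r) →
        arcMassIf Λ s(u₀, v₀) s(u₁, v₁) (UnforcedCrossing Λ v₀ v₁ x r R) ≤
          q * arcMass Λ s(u₀, v₀) s(u₁, v₁)

/-- Lattice G2 in SIMPLY CONNECTED domains (`Λᶜ` preconnected: the regime of the parafermionic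
observable — pasts attached to the lattice boundary). -/
def LatticeG2SC : Prop :=
  LatticeG2With hexDomainSimplyConnected

/-- Lattice G2 in ALL finite domains (holes allowed: floating pasts from interior lattice
endpoints, the (G1) gap of triage r1-3). -/
def LatticeG2 : Prop :=
  LatticeG2With fun _ => True

/-- **Aizenman–Burchard hypothesis (H1) for the hexagonal SAW law in `(D; a, b)`** — VERBATIM the
body of `Disproof.HexTraversalBound` (`Cruxes/HexTight/Disproof.lean`, gen 2, §6), restated so that
the stubs do not depend on the disprover's work file (`traversalBound_iff` records the
definitional agreement; only `HexTight_of` uses a Disproof theorem): a shell-dependent threshold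
`k`, constants `K ≥ 0`, `λ > 2`, `δ₀ > 0`, and for `δ ∈ (0, δ₀]`, `δ ≤ ρ < R ≤ 1` the probability
of `k x ρ R` separate traversals of `D(x; ρ, R)` by the SAW polyline is `≤ K (ρ/R)^λ`. -/
def HexTraversalBound (D : DobrushinDomain) (a b : ℝ → HexVertex) : Prop :=
  ∃ (k : ℂ → ℝ → ℝ → ℕ) (K lam δ₀ : ℝ), 0 ≤ K ∧ 2 < lam ∧ 0 < δ₀ ∧
    ∀ δ ∈ Set.Ioc 0 δ₀, ∀ (x : ℂ) (ρ R : ℝ), δ ≤ ρ → ρ < R → R ≤ 1 →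
      hexSAWLaw D.carrier δ (a δ) (b δ)
        {γ | (⟨γ.walk.toCurve fun w => (δ : ℂ) * hexCenter w⟩ : Curve ℂ).HasTraversals
          (k x ρ R) x ρ R} ≤ ENNReal.ofReal (K * (ρ / R) ^ lam)

/-- The local `HexTraversalBound` is definitionally the disprover's. -/
theorem traversalBound_iff (D : DobrushinDomain) (a b : ℝ → HexVertex) :
    HexTraversalBound D a b ↔ Disproof.HexTraversalBound D a b :=
  Iff.rfl

/-! ## §3 Registered stubs -/

/-- (S1) No return to the tip at all scales — see `TipNoReturn`. -/
theorem stub_tipNoReturn : TipNoReturn := by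
  sorry

/-- (S2) Tip renewal: re-basing the source at lattice scale costs `K(k)` — see `TipRebasing`. -/
theorem stub_tipRebasing : TipRebasing := by
  sorry

/-- (S3) Coherent decay from thick sources — see `CoherentDecay`. -/
theorem stub_coherentDecay : CoherentDecay := by
  sorry

/-- (S4) Pinned decoupling — see `PinnedDecoupling`. HARDEST stub (no mechanism on record). -/
theorem stub_pinnedDecoupling : PinnedDecoupling := by
  sorry

/-- **(S5) Assembly: lattice G2 in simply connected domains.** A genuine reduction (size M–L),
no estimate hidden:
(i) SIDES LEMMA (lattice form of triage r1-2 (X2) / r1-3 App. E): in a simply connected `Λ`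
the two feet of a radial crossing through an annulus component `V` (outer foot at radius `≥ R`,
inner foot at radius `≤ r`) lie in DIFFERENT components of `Λ ∖ V` (a joining path avoiding `V`
would pass the radii `(r, R)` inside another component `V'`, and the resulting lattice cycle
through `V` and `V'` would enclose the complement barrier separating them, against
`hexDomainSimplyConnected`; planarity of the honeycomb embedding: edge paths that cross share a
vertex). Consequently a PINNED walk `t → z` making a KS-unforced crossing of `A(x; r, R)` (its
component `V` avoidable: `v_t`, `v_z` joined in `Λ ∖ V`) makes a side excursion with
`(p, p') = (v_t, v_z)`: `UnforcedCrossing ⊆ SideExcursion` on `HexMidEdgeSAW Λ t z` (first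
vertex `v_t`, last vertex `v_z`), while through-passages and corridor dips — the forced
configurations — are side excursions for NO choice of `(p, p')`;
(ii) `PinnedDecoupling`: the pinned side-excursion fraction is `≤ K ×` the unpinned CONDITIONAL
fraction from `t` (given `Engages x R t`);
(iii) the conditional fraction from `t` is `≤ ε` by `TipNoReturn` if `dist(x, t) < R`, and
`≤ K(k)·ε` by `TipRebasing` + `CoherentDecay` (thick doors of `Λ ∖ B(t, 2k)` at distance
`≥ R/2`, `R ≥ 8k`) if `dist(x, t) ≥ R` — no renewal is needed at this level (the conditioning is
built into S1–S3; first-entry renewal and the complementarity floor live inside their proofs);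
(iv) choose `k = 1`, `ε` with `K · max(1, K(1)) · ε ≤ 1/2`, then `C ≥ 2`, `n₁ ≥ 8` from S1/S3/S4. -/
theorem stub_latticeG2sc_of :
    TipNoReturn → TipRebasing → CoherentDecay → PinnedDecoupling → LatticeG2SC := by
  sorry

/-- **(S6) Floating pasts / holes — the (G1) residual.** Lattice G2 for simply connected domains
implies it for all finite domains. The conditional law of `hexSAWLaw` given a past started at an
INTERIOR lattice endpoint `a δ` (allowed by `IsEmbEndpointApprox`: only `δ·hexCenter (a δ) → a`
is asked) lives in a slit domain whose removed set (past ∪ outside) is disconnected, where the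
observable's boundary phases pick up the monodromy `e^{-iσ·2πk}` of windings around the floating
past and the SIDES LEMMA fails (a second exit around the hole). No reduction is on record
(triage r1-3 (G1): "a reduction … or a typed restriction is owed"); candidate: induct on the
number of complementary components, cutting along a shortest lattice path from the hole to the
outer complement and summing over the last crossing of the cut. Shared debt of every
parafermionic line for this crux. Size: open. -/
theorem stub_floatingPast : LatticeG2SC → LatticeG2 := by
  sorry

/-- **(S7) Dictionary + Kemppainen–Smirnov ⇒ Aizenman–Burchard (H1).** From lattice G2 to
`HexTraversalBound D a b` for every Dobrushin domain and endpoint approximation: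
(a) DICTIONARY (size M): for `δ` in the honest window (`a δ ≠ b δ` joined;
`Disproof.eventually_ne_and_reachable`), the `hexSAWLaw`-probability of a prefix cylinder
`{γ | ∃ φ, γ.walk = η.append φ}` intersected with a future event is a ratio of `x_c`-weighted path
sums in the slit domain `Λ_η = (Ω_δ-vertices) ∖ η` from the tip mid-edge `{η₋₂, η₋₁}` (domain
Markov property; `Ω_δ` finite by `Disproof.finite_embMeshDomain`), the target VERTEX `b δ`
being encoded by deleting it and summing over its ≤ 3 boundary mid-edges, and positions
rescaled by `δ` (`r ↦ r/δ`). CAVEAT (triage r1-3 (G2)): `embMeshGraph` drops honeycomb edges whose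
rescaled segment leaves `closure Ω` — possible at every mesh near inward cusps, and for sporadic
`δ → 0` even for smooth non-convex `Ω` — so `Ω_δ` is a hexagonal domain WITH CUT EDGES; the
Duminil-Copin–Smirnov vertex relation survives edge cuts once both half-mid-edges of a cut edge
are treated as boundary mid-edges (paper check in the line card), but the tree's
`HexMidEdgeSAW`/`hexParafermionicObservable` are uncut: S1–S6 are to be re-read on edge-deleted
domains (definition request in the line card).
(b) KS17 Prop. 3.5 with Lemma 3.6 (arXiv:1212.6215 §3.2), lattice version: for a shell
`D(x; ρ, R)` containing `n = ⌊log_C(R/ρ)/3⌋` disjoint triples of `C`-adic sub-annuli, `n₀ + 2m`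
traversals force, in each triple, `≥ m` crossings UNFORCED AT THEIR OWN STARTING TIMES (index
counting), hence probability `≤ q^{m n} ≤ C^{3m} (ρ/R)^{m log(1/q)/(3 log C)}`; here
`n₀ = n₀(D, a, b; x, ρ, R) = sup_{δ ≤ δ₀}` (minimal number of shell crossings of lattice paths
`a δ → b δ` in `Ω_δ`), FINITE for each shell (Jordan domain; `δ·hexCenter (a δ) → a`, large `δ`
bounded by the vertex count) and shell-dependent — exactly the threshold `k x ρ R` of
`HexTraversalBound` (a constant threshold is false near rough marked points, Disproof §6); choose
`m` with `m log(1/q) > 6 log C`.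
(c) Scales below the cutoff `n₁ δ` are absorbed into `K` (factor `n₁^λ`) or admit no `k`-fold
traversal at all (`Disproof.not_hasTraversals_sawCurve`-type count). Size L–XL; natural glued split
(D-0019): S7a `LatticeG2 → HexLawG2` (the law-model conditional bound on prefix cylinders),
S7b `HexLawG2 → …`. -/
theorem stub_traversalBound_of :
    LatticeG2 → ∀ (D : DobrushinDomain) (a b : ℝ → HexVertex),
      IsEmbEndpointApprox hexGraph hexCenter D a b → HexTraversalBound D a b := by
  sorry

/-! ## §4 The kernel-checked composition -/

/-- **The line concludes the crux (hypothesis form).** `TipNoReturn`, `TipRebasing`,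
`CoherentDecay`, `PinnedDecoupling` give lattice G2 in simply connected domains (S5), S6 extends it
to all slit domains, S7 turns it into the Aizenman–Burchard hypothesis (H1) for every `(D, a, b)`,
and the disprover's checked rung `Disproof.crux_of_traversalBound` (AB criterion
`isTightMeasureSet_of_traversalBounds` + the proved cutoff (H0) `not_hasTraversals_sawCurve` +
`isTightAlongMesh_of_isTightMeasureSet_image`) yields `HexTight` — here by the name of the
PRIMARY route's copy, `SAWDevelopingMap.HexTight` (= `Disproof.Crux`). No `sorry`. -/
theorem HexTight_of :
    TipNoReturn → TipRebasing → CoherentDecay → PinnedDecoupling →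
    (TipNoReturn → TipRebasing → CoherentDecay → PinnedDecoupling → LatticeG2SC) →
    (LatticeG2SC → LatticeG2) →
    (LatticeG2 → ∀ (D : DobrushinDomain) (a b : ℝ → HexVertex),
      IsEmbEndpointApprox hexGraph hexCenter D a b → HexTraversalBound D a b) →
    Summit.CriticalPhenomena.SAWScalingLimit.Theses.SAWDevelopingMap.HexTight :=
  fun h₁ h₂ h₃ h₄ h₅ h₆ h₇ =>
    Disproof.crux_of_traversalBound fun D a b hab =>
      (traversalBound_iff D a b).1 (h₇ (h₆ (h₅ h₁ h₂ h₃ h₄)) D a b hab)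

/-- **The crux from the registered stubs** — the skeleton theorem the gate audits
(`#h21_check_skeleton`): it concludes, BY NAME and with no hypotheses, the item's keyed copy
`SAWResidueField.HexTight` of stmt-CriticalPhenomena-5423 (the four route copies
SAWResidueField / SAWWindingAlias / SAWDevelopingMap / SAWPhaseRetrieval are syntactically equal,
so `HexTight_of`'s conclusion converts definitionally); the only axiom beyond the kernel's is the
`sorryAx` of the seven `stub_*`. -/
theorem HexTight_proof : Summit.CriticalPhenomena.SAWScalingLimit.Theses.SAWResidueField.HexTight :=
  HexTight_of stub_tipNoReturn stub_tipRebasing stub_coherentDecay stub_pinnedDecoupling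
    stub_latticeG2sc_of stub_floatingPast stub_traversalBound_of

end Summit.CriticalPhenomena.SAWScalingLimit.Cruxes.HexTight.TipRenewalComplementarity
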